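import Summits.BirchSwinnertonDyer.BirchSwinnertonDyer.Theorems.Rank1ResidualJetSwapStep
import Summits.BirchSwinnertonDyer.BirchSwinnertonDyer.Theorems.KatoDescentTamePotSupersingularJetchevIrreducibleSwapPrime
import Summits.BirchSwinnertonDyer.BirchSwinnertonDyer.Theorems.KatoDescentTamePotSupersingularJetchevIrreducibleSwapPlumbing
import HarnessLib

/-!
# Crux `JetchevIrreducibleReadingByName` (item 20165, shared K8-t′ / K9, cell `bsd-potss`), registered stub S2′
# `stub_prop52IrredP` (McCallum 1991 Prop. 5.2 in the IRREDUCIBLE reading): Kolyvagin's PRIME SWAP `n ↦ n·ℓ'/ℓ₀` at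
# minimal depth, the `λ₀` half — cell `bsd-jet`'s `JET.Swap.not_dvd_of_swap` PORTED to `E[p]` irreducible + `p ∣ N_E`

Seat `bsd-potss-k8t-c4` g12 (prover), `--supports stmt-BirchSwinnertonDyer-20165`, helper; route-free. HONEST
FRAMING: helper theorems only; nothing is booked, no item closes, BSD is proved for no curve by any of this.

WHAT. Cell `bsd-jet` (seat pv-2 g6, `Rank1ResidualJetSwapStep`, p548164) proved the `λ₀` half of McCallum's prime swap
(LMS LN 153, proof of Prop. 5.2, p. 306): for COMPATIBLE data `d ≼ d'` (`n ∣ nℓ'`) and `d'' ≼ d'` (`n'' = nℓ'/ℓ₀ ∣ nℓ'`),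
Prop. 4.4 at `λ'` moves `loc_{λ'} c_{1+u}(P_n) ≠ 0` to `c_{1+u}(P_{nℓ'})`; its root class `y` (exact depth `u` by
MINIMALITY `hmin`; sign `−e₀`; Selmer) is NOT Kummer at `λ'`; the EXCLUSION LEMMA (`JET.Swap.localization_eq_zero_of_strict_of_relaxed`,
p544205, Selmer-structure level, image-free) with the auxiliary class `t` forbids `loc_{λ₀} y = 0`; Prop. 4.4 at `λ₀`
gives `c_{1+u}(P_{n''}) ≠ 0`, i.e. `p^{u+1} ∤ P_{n''}`. That proof is in the SURJECTIVE frame (`p`-adic tower onto,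
Prop. 4.4 as the typed fact `h44`). This file is the same theorem on the rows `E[p]` IRREDUCIBLE, `p ∣ N_E`:
* the image enters pv-2's proof through `Walk.torsionH1OfDvd_rootClass`, `JET.sign_conjAct_kolyvaginClass`,
  `torsionH1OfDvd_pow_injective`, `Walk.rootClass_mem_selmerGroup_selmerF_of_levelUp` — replaced by
  `…torsionH1OfDvd_rootClass_of_admissible` (`…SwapPlumbing`), k9-c4's `…sign_conjAct_kolyvaginClass_of_irreducible`,
  `torsionH1OfDvd_pow_injective_of_irreducible` (`…SwapPrime`), `rootClass_mem_selmerGroup_selmerF_of_levelUp_of_irreducible`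
  (`…SwapPlumbing`; [GZ86 III (3.1)] in the Kolyvagin-SCOPED receptacle shape);
* McCallum Prop. 4.4 is carried as the ROW-LEVEL binder `h47row` (localisation-order form = the conclusion shape of
  k8t-c4's adapters `…addOrderOf_localization_kolyvaginClass_mul_eq_of_prop47IrredP2` / `…_of_prop47IrredP`) with a
  GUARD PREDICATE `G` on the swapped prime (`G := (· ≠ 2)` for the `h47P2` keying, `⊤` for `h47P`), used at `ℓ'` and `ℓ₀`.
Everything else (PT package + Weil datum, `𝒯` with `h𝒯σ`/`h𝒯sd`/`hloc`/`hdisj`, `hmin`, data triples) is VERBATIM pv-2.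
References (locators only): [cite: McCallumLMS1991, §5 Prop. 5.2 and proof (pp. 304–306), §4 Prop. 4.4]
[cite: Jetchev2008, §3.1 item 7, Lemma 5.2, Thm. 5.1, Rem. 6.2] [cite: GrossZagier1986, III (3.1)] [cite: GrossLMS1991, §6 Prop. 6.2 (1)]
Design: theorems only; `K : Type`. Axioms: `propext`, `Classical.choice`, `Quot.sound`. -/

set_option autoImplicit false
-- the Theorems directory repeats the summit name (sibling precedent `KatoDescentPotSupersingularAssembly.lean`)
set_option linter.dupNamespace false

noncomputable section
open scoped Classical Pointwise
open Function NumberField IsDedekindDomain WeierstrassCurve Field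
open Literature.NumberTheory.EllipticCurves Literature.NumberTheory.GaloisRepresentations
open Literature.NumberTheory.EllipticCurves.Jetchev2008 Literature.NumberTheory.EllipticCurves.KolyvaginCocycle
open Literature.NumberTheory.EllipticCurves.ModularForms
open Literature.NumberTheory.GaloisCohomology Literature.NumberTheory.Automorphic
open Literature.NumberTheory.GaloisRepresentations.DiscreteGaloisModule (transverseSubgroup SelmerStructure)
open Summit.BirchSwinnertonDyer.Rank1Residual
open Summit.BirchSwinnertonDyer.Rank1Residual.JET
open Summit.BirchSwinnertonDyer.Rank1Residual.JET.SelmerVocabulary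
open Summit.BirchSwinnertonDyer.Rank1Residual.JET.GlobalDuality
open Summit.BirchSwinnertonDyer.Rank1Residual.JET.Swap
open Summit.BirchSwinnertonDyer.Rank1Residual.X11b
open Summit.BirchSwinnertonDyer.Rank1Residual.X11b.Three
open Summit.BirchSwinnertonDyer.BirchSwinnertonDyer.Theorems

namespace Summit.BirchSwinnertonDyer.BirchSwinnertonDyer.Theorems.JetchevIrreducibleSwap

variable {K : Type} [Field K] [NumberField K] (W : WeierstrassCurve ℚ) [W.IsElliptic]
  [W.IsGloballyMinimal] [NeZero (W.conductorNorm ℤ)]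

section Prime

variable (τ : K ≃ₐ[ℚ] K) (p : ℕ) [Fact p.Prime] [NeZero (p ^ 1)]
  [Finite (geomTorsion (W.baseChange K) ((p ^ 1 : ℕ) : ℤ))]
  (e : geomTorsion (W.baseChange K) ((p ^ 1 : ℕ) : ℤ) → geomTorsion (W.baseChange K) ((p ^ 1 : ℕ) : ℤ) →
    AlgebraicClosure K)
  (hμ : ∀ S T, e S T ^ (p ^ 1) = 1)
  (hadd₁ : ∀ S₁ S₂ T, e (S₁ + S₂) T = e S₁ T * e S₂ T)
  (hadd₂ : ∀ S T₁ T₂, e S (T₁ + T₂) = e S T₁ * e S T₂)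
  (hgal : ∀ (g : absoluteGaloisGroup K) (S T : geomTorsion (W.baseChange K) ((p ^ 1 : ℕ) : ℤ)),
    g • e S T = e (g • S) (g • T))
  (halt : ∀ T, e T T = 1) (hnondeg : ∀ T, (∀ S, e S T = 1) → T = 0)
  (hτe : ∀ S T, liftAut τ (e S T) =
    e ((isLiftOfAut_liftAut τ).torsionMap W ((p ^ 1 : ℕ) : ℤ) S)
      ((isLiftOfAut_liftAut τ).torsionMap W ((p ^ 1 : ℕ) : ℤ) T))

set_option maxHeartbeats 400000 in
include halt hnondeg hτe in
/-- **The `λ₀` half of Kolyvagin's swap on an IRREDUCIBLE row: `p^{u+1} ∤ P_{n''}`, `n'' = nℓ'/ℓ₀`** (McCallum,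
proof of Prop. 5.2, p. 306, run at level `p` on the root classes) — cell `bsd-jet` pv-2's `JET.Swap.not_dvd_of_swap`
VERBATIM with the surjective frame replaced by {`E[p]` irreducible, `p ∣ N_E`} and McCallum Prop. 4.4 carried as the
ROW-LEVEL binder `h47row` (localisation-order form, guarded by a predicate `G` on the swapped prime: `G ℓ'`, `G ℓ₀`);
see the module docstring for the data and the proof. [cite: McCallumLMS1991, §5 proof of Prop. 5.2 (pp. 305–306), §4 Prop. 4.4]
[cite: Jetchev2008, §3.1 item 7, Lemma 5.2, Rem. 6.2] [cite: GrossZagier1986, III (3.1)] -/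
theorem not_dvd_of_swap_of_irreducible (hK : IsImaginaryQuadratic K)
    (hD3 : NumberField.discr K ≠ -3) (hD4 : NumberField.discr K ≠ -4)
    (hH : SatisfiesHeegnerHypothesis (W.conductorNorm ℤ) K) (hp2 : p ≠ 2)
    (hirr : W.HasIrreducibleModPGaloisRep p) (hpN : p ∣ W.conductorNorm ℤ) (hτ1 : τ ≠ 1) (hττ : τ * τ = 1)
    (Dt : ModularParametrizationData W (W.conductorNorm ℤ)) (β : ℤ) (ι : K →+* ℂ)
    [∀ j : ℕ, NumberField (ringClassField K ι j)]
    (G : ℕ → Prop)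
    (h47row : ∀ (M : ℕ), 1 ≤ M → ∀ (m l : ℕ), Squarefree (m * l) → l.Prime → G l → ¬ l ∣ m →
      (∀ l' ∈ (m * l).primeFactors, Zhang2014.IsKolyvaginPrime (W.conductorNorm ℤ) W K p l' ∧
        M ≤ Zhang2014.kolyvaginIndex W p l') →
      ∀ (d : KolyvaginHeegnerData Dt β ι m) (d' : KolyvaginHeegnerData Dt β ι (m * l)),
      (∀ l' ∈ m.primeFactors, ∀ (x : ringClassField K ι m) (x' : ringClassField K ι (m * l)),
        (x : ℂ) = x' → ((d'.σ l' x' : ringClassField K ι (m * l)) : ℂ) = (d.σ l' x : ℂ)) →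
      (∀ s ∈ d.S, ∃ s' ∈ d'.S, ∀ (x : ringClassField K ι m) (x' : ringClassField K ι (m * l)),
        (x : ℂ) = x' → ((s' x' : ringClassField K ι (m * l)) : ℂ) = (s x : ℂ)) →
      (∀ s' ∈ d'.S, ∃ s ∈ d.S, ∀ (x : ringClassField K ι m) (x' : ringClassField K ι (m * l)),
        (x : ℂ) = x' → ((s' x' : ringClassField K ι (m * l)) : ℂ) = (s x : ℂ)) →
      (∀ (x : ringClassField K ι m) (x' : ringClassField K ι (m * l)),
        (x : ℂ) = x' → d'.emb x' = d.emb x) →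
      ∀ (v : HeightOneSpectrum (𝓞 K)), (l : 𝓞 K) ∈ v.asIdeal →
      addOrderOf ((galoisCohomology.localization
          ((W.baseChange K).torsionGaloisModule ((p ^ M : ℕ) : ℤ)) (Sum.inr v) 1 :
            galH1Torsion (W.baseChange K) ((p ^ M : ℕ) : ℤ) →+ _)
          (d'.kolyvaginClass (Fact.out : p.Prime) M)) =
        addOrderOf ((galoisCohomology.localization
          ((W.baseChange K).torsionGaloisModule ((p ^ M : ℕ) : ℤ)) (Sum.inr v) 1 :
            galH1Torsion (W.baseChange K) ((p ^ M : ℕ) : ℤ) →+ _)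
          (d.kolyvaginClass (Fact.out : p.Prime) M)))
    (inv : LocalInvariants K (p ^ 1)) (hperf : inv.IsPerfect) (hvan : inv.SumLocalTermEqZero)
    (hSC : inv.SelmerComplement) (hinv : inv.IsConjCompatible τ)
    (𝒯 : SelmerStructure ((W.baseChange K).torsionGaloisModule ((p ^ 1 : ℕ) : ℤ)))
    (h𝒯 : ∀ v : HeightOneSpectrum (𝓞 K), 𝒯 (Sum.inr v) =
      ⨅ (ℓ : ℕ) (_ : ℓ.Prime ∧ (ℓ : 𝓞 K) ∈ v.asIdeal),
        ⨅ (w' : HeightOneSpectrum (𝓞 (ringClassField K ι ℓ)))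
          (_ : w'.asIdeal.LiesOver v.asIdeal),
          letI := (adicCompletionOfLiesOver K (ringClassField K ι ℓ) v w').toAlgebra
          transverseSubgroup (GaloisRep.toLocal v ((W.baseChange K).torsionGaloisModule ((p ^ 1 : ℕ) : ℤ)))
            (w'.adicCompletion (ringClassField K ι ℓ)))
    (h𝒯σ : ∀ (c : ℕ), Squarefree c →
      (∀ q ∈ c.primeFactors, Zhang2014.IsKolyvaginPrime (W.conductorNorm ℤ) W K p q) →
      ∀ (v w : HeightOneSpectrum (𝓞 K)) (h : τ • v = w), v ∈ placesDividing K c →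
      ∀ x : galoisCohomology (((W.baseChange K).torsionGaloisModule ((p ^ 1 : ℕ) : ℤ)).toLocal
        (Sum.inr v : Place K)) 1,
      x ∈ 𝒯 (Sum.inr v) → conjActPlace W τ ((p ^ 1 : ℕ) : ℤ) h x ∈ 𝒯 (Sum.inr w))
    (h𝒯sd : ∀ (c : ℕ), Squarefree c →
      (∀ q ∈ c.primeFactors, Zhang2014.IsKolyvaginPrime (W.conductorNorm ℤ) W K p q) →
      ∀ v ∈ placesDividing K c,
      inv.dualTransported 𝒯 (weilDualIntertwining (W.baseChange K) (p ^ 1) e hμ hadd₁ hadd₂ hgal)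
        (Sum.inr v) = 𝒯 (Sum.inr v))
    (hloc : ∀ ℓ : ℕ, Zhang2014.IsKolyvaginPrime (W.conductorNorm ℤ) W K p ℓ →
      1 ≤ Zhang2014.kolyvaginIndex W p ℓ →
      ∀ (v : HeightOneSpectrum (𝓞 K)), (ℓ : 𝓞 K) ∈ v.asIdeal → ∀ (hfix : τ • v = v) (s : ℤ),
      (s = 1 ∨ s = -1) →
      ((W.baseChange K).kummerSelmerStructure ((p ^ 1 : ℕ) : ℤ) (Sum.inr v)).relIndex
        ((conjActPlace W τ ((p ^ 1 : ℕ) : ℤ) hfix - s • AddMonoidHom.id _).ker) = p ^ 1)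
    (hdisj : ∀ ℓ : ℕ, Zhang2014.IsKolyvaginPrime (W.conductorNorm ℤ) W K p ℓ →
      ∀ v : HeightOneSpectrum (𝓞 K), (ℓ : 𝓞 K) ∈ v.asIdeal →
      Disjoint ((W.baseChange K).kummerSelmerStructure ((p ^ 1 : ℕ) : ℤ) (Sum.inr v)) (𝒯 (Sum.inr v)))
    {n' : ℤ} (hcop' : IsCoprime (p : ℤ) n')
    (hGZ : ∀ (m : ℕ), Squarefree m →
      (∀ q ∈ m.primeFactors, Zhang2014.IsKolyvaginPrime (W.conductorNorm ℤ) W K p q) →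
      ∀ (dm : KolyvaginHeegnerData Dt β ι m)
      (γ : ringClassField K ι m ≃ₐ[ℚ] ringClassField K ι m), γ ∈ ringClassGal ι m →
      ∀ v : HeightOneSpectrum (𝓞 K), ¬ (W.baseChange K).HasGoodReductionAt v →
        n' • pointsMap (W.baseChange K) (v.adicCompletion K)
            (dm.toGeomPoints (pointGalHom W (ringClassField K ι m) γ dm.y)) ∈
          E0Receptacle (W.baseChange K) v ∧
        ∀ (ℓ : ℕ), ℓ ∈ m.primeFactors → ∀ (dm' : KolyvaginHeegnerData Dt β ι (m / ℓ))
          (hle : ringClassField K ι (m / ℓ) ≤ ringClassField K ι m),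
          n' • pointsMap (W.baseChange K) (v.adicCompletion K)
              (dm.toGeomPoints (pointGalHom W (ringClassField K ι m) γ
                (WeierstrassCurve.Affine.Point.map (W' := W)
                  ((RingClassField.inclusion ι hle).restrictScalars ℚ) dm'.y))) ∈
            E0Receptacle (W.baseChange K) v)
    {u : ℕ}
    (hmin : ∀ (c : ℕ), Squarefree c →
      (∀ q ∈ c.primeFactors, Zhang2014.IsKolyvaginPrime (W.conductorNorm ℤ) W K p q ∧
        1 + u ≤ Zhang2014.kolyvaginIndex W p q) →
      ∀ dc : KolyvaginHeegnerData Dt β ι c,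
      ∃ Q : (W.baseChange (ringClassField K ι c)).toAffine.Point, ((p ^ u : ℕ) : ℤ) • Q = dc.derivedPoint)
    {n l₀ ℓ' : ℕ} (hn : Squarefree n)
    (hnK : ∀ q ∈ n.primeFactors, Zhang2014.IsKolyvaginPrime (W.conductorNorm ℤ) W K p q ∧
      1 + u ≤ Zhang2014.kolyvaginIndex W p q)
    (hl₀ : l₀ ∈ n.primeFactors) (hKol' : Zhang2014.IsKolyvaginPrime (W.conductorNorm ℤ) W K p ℓ')
    (h1u : 1 + u ≤ Zhang2014.kolyvaginIndex W p ℓ') (hℓ'n : ℓ' ∉ n.primeFactors)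
    (hGℓ' : G ℓ') (hGl₀ : G l₀)
    {v' v₀ : HeightOneSpectrum (𝓞 K)} (hv' : (ℓ' : 𝓞 K) ∈ v'.asIdeal) (hv₀ : (l₀ : 𝓞 K) ∈ v₀.asIdeal)
    (d : KolyvaginHeegnerData Dt β ι n) (d' : KolyvaginHeegnerData Dt β ι (n * ℓ'))
    (hσ : ∀ q ∈ n.primeFactors, ∀ (x : ringClassField K ι n) (x' : ringClassField K ι (n * ℓ')),
      (x : ℂ) = x' → ((d'.σ q x' : ringClassField K ι (n * ℓ')) : ℂ) = (d.σ q x : ℂ))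
    (hS : ∀ s ∈ d.S, ∃ s' ∈ d'.S, ∀ (x : ringClassField K ι n) (x' : ringClassField K ι (n * ℓ')),
      (x : ℂ) = x' → ((s' x' : ringClassField K ι (n * ℓ')) : ℂ) = (s x : ℂ))
    (hS' : ∀ s' ∈ d'.S, ∃ s ∈ d.S, ∀ (x : ringClassField K ι n) (x' : ringClassField K ι (n * ℓ')),
      (x : ℂ) = x' → ((s' x' : ringClassField K ι (n * ℓ')) : ℂ) = (s x : ℂ))
    (hemb : ∀ (x : ringClassField K ι n) (x' : ringClassField K ι (n * ℓ')),
      (x : ℂ) = x' → d'.emb x' = d.emb x)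
    (hxup : galoisCohomology.localization ((W.baseChange K).torsionGaloisModule ((p ^ (1 + u) : ℕ) : ℤ))
        (Sum.inr v' : Place K) 1 (d.kolyvaginClass (Fact.out : p.Prime) (1 + u)) ≠ 0)
    (t : galoisCohomology ((W.baseChange K).torsionGaloisModule ((p ^ 1 : ℕ) : ℤ)) 1)
    (ht : t ∈ signPart W K τ ((p ^ 1 : ℕ) : ℤ) (-(-W.rootNumber * (-1) ^ n.primeFactors.card))
        (((selmerF W ((p ^ 1 : ℕ) : ℤ) 𝒯 (placesDividing K (n / l₀))).relaxedAt {v₀}).selmerGroup))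
    (htv' : galoisCohomology.localization ((W.baseChange K).torsionGaloisModule ((p ^ 1 : ℕ) : ℤ))
        (Sum.inr v' : Place K) 1 t ≠ 0)
    (d'' : KolyvaginHeegnerData Dt β ι (n / l₀ * ℓ'))
    (hσ₁ : ∀ q ∈ (n / l₀ * ℓ').primeFactors, ∀ (x : ringClassField K ι (n / l₀ * ℓ'))
      (x' : ringClassField K ι (n * ℓ')),
      (x : ℂ) = x' → ((d'.σ q x' : ringClassField K ι (n * ℓ')) : ℂ) = (d''.σ q x : ℂ))
    (hS₁ : ∀ s ∈ d''.S, ∃ s' ∈ d'.S, ∀ (x : ringClassField K ι (n / l₀ * ℓ'))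
      (x' : ringClassField K ι (n * ℓ')),
      (x : ℂ) = x' → ((s' x' : ringClassField K ι (n * ℓ')) : ℂ) = (s x : ℂ))
    (hS₁' : ∀ s' ∈ d'.S, ∃ s ∈ d''.S, ∀ (x : ringClassField K ι (n / l₀ * ℓ'))
      (x' : ringClassField K ι (n * ℓ')),
      (x : ℂ) = x' → ((s' x' : ringClassField K ι (n * ℓ')) : ℂ) = (s x : ℂ))
    (hemb₁ : ∀ (x : ringClassField K ι (n / l₀ * ℓ')) (x' : ringClassField K ι (n * ℓ')),
      (x : ℂ) = x' → d'.emb x' = d''.emb x) :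
    ¬ ∃ Q : (W.baseChange (ringClassField K ι (n / l₀ * ℓ'))).toAffine.Point,
      ((p ^ (u + 1) : ℕ) : ℤ) • Q = d''.derivedPoint := by
  have hp : p.Prime := Fact.out
  have hD : NumberField.discr K < -4 := KolyvaginAssembly.discr_lt_neg_four hK ⟨hD3, hD4⟩
  have hn0 : n ≠ 0 := hn.ne_zero
  have hl₀p : l₀.Prime := Nat.prime_of_mem_primeFactors hl₀
  have hl₀n : l₀ ∣ n := Nat.dvd_of_mem_primeFactors hl₀
  have hKol₀ : Zhang2014.IsKolyvaginPrime (W.conductorNorm ℤ) W K p l₀ := (hnK l₀ hl₀).1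
  have hℓ'p : ℓ'.Prime := hKol'.1
  have hℓ'0 : ℓ' ≠ 0 := hℓ'p.ne_zero
  have hℓ'dvd : ¬ ℓ' ∣ n := fun h ↦ hℓ'n (Nat.mem_primeFactors.mpr ⟨hℓ'p, h, hn0⟩)
  have hdn : p ^ 1 ∣ p ^ (1 + u) := pow_dvd_pow p (Nat.le_add_right 1 u)
  set e₀ : ℤ := -W.rootNumber * (-1) ^ n.primeFactors.card with he₀def
  have hN : Squarefree (n * ℓ') :=
    (Nat.squarefree_mul ((Nat.Prime.coprime_iff_not_dvd hℓ'p).mpr hℓ'dvd).symm).mpr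
      ⟨hn, hℓ'p.squarefree⟩
  have hN0 : n * ℓ' ≠ 0 := hN.ne_zero
  have hNpf : (n * ℓ').primeFactors = n.primeFactors ∪ {ℓ'} := by
    rw [Nat.primeFactors_mul hn0 hℓ'0, hℓ'p.primeFactors]
  have hNK : ∀ q ∈ (n * ℓ').primeFactors, Zhang2014.IsKolyvaginPrime (W.conductorNorm ℤ) W K p q ∧
      1 + u ≤ Zhang2014.kolyvaginIndex W p q := by
    intro q hq
    rw [hNpf, Finset.mem_union, Finset.mem_singleton] at hq
    rcases hq with hq | rfl
    · exact hnK q hq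
    · exact ⟨hKol', h1u⟩
  have hNcard : (n * ℓ').primeFactors.card = n.primeFactors.card + 1 := by
    rw [hNpf, Finset.card_union_of_disjoint (Finset.disjoint_singleton_right.mpr hℓ'n),
      Finset.card_singleton]
  have h44' := h47row (1 + u) (by omega) n ℓ' hN hℓ'p hGℓ' hℓ'dvd hNK d d' hσ hS hS' hemb v' hv'
  have hκ'v' : galoisCohomology.localization ((W.baseChange K).torsionGaloisModule ((p ^ (1 + u) : ℕ) : ℤ))
      (Sum.inr v' : Place K) 1 (d'.kolyvaginClass hp (1 + u)) ≠ 0 := by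
    intro h
    have h' := h44'
    rw [show (galoisCohomology.localization ((W.baseChange K).torsionGaloisModule ((p ^ (1 + u) : ℕ) : ℤ))
      (Sum.inr v' : Place K) 1 : galH1Torsion (W.baseChange K) ((p ^ (1 + u) : ℕ) : ℤ) →+ _)
      (d'.kolyvaginClass hp (1 + u)) = 0 from h, addOrderOf_zero] at h'
    exact hxup (AddMonoid.addOrderOf_eq_one_iff.mp h'.symm)
  have hκ'0 : d'.kolyvaginClass hp (1 + u) ≠ 0 := fun h ↦ hκ'v' (by rw [h]; exact map_zero _)
  obtain ⟨hA', hP'⟩ := d'.kolyvaginClass_ne_zero hκ'0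
  have hdvd' := hmin (n * ℓ') hN hNK d'
  have hndvd' : ¬ ∃ Q : (W.baseChange (ringClassField K ι (n * ℓ'))).toAffine.Point,
      ((p ^ (u + 1) : ℕ) : ℤ) • Q = d'.derivedPoint := by
    rintro ⟨Q, hQ⟩
    apply hκ'0
    have := (zsmul_kolyvaginClass_eq_zero_iff d' hp (1 + u) hA' hP' 1).mpr
      ⟨Q, by rw [one_zsmul, Nat.add_comm]; exact hQ⟩
    rwa [one_zsmul] at this
  obtain ⟨hA1', Q', hQ', hQ'P, hord', -⟩ :=
    Koly.exists_tildeClass_of_exactDepth d' hp (k := 1) (u := u) le_rfl hA' hP' hdvd' hndvd'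
  set y : galH1Torsion (W.baseChange K) ((p ^ 1 : ℕ) : ℤ) :=
    kolyvaginClass (W.baseChange K) ((p ^ 1 : ℕ) : ℤ)
      ((W.baseChange K).zsmul_geomPoints_surjective_of_charZero
        (by exact_mod_cast pow_ne_zero 1 hp.ne_zero)) hA1' (d'.toGeomPoints Q') hQ' with hydef
  have hrooty := torsionH1OfDvd_rootClass_of_admissible W hp d' 1 u Q' hA1' hQ' hQ'P hA' hP'
  obtain ⟨-, hκ'sign⟩ := JetchevIrreducibleReadingSign.sign_conjAct_kolyvaginClass_of_irreducible hK hD3 hD4 hH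
    hp2 hirr hpN τ hτ1 Dt β ι hN (k := 1 + u) (by omega) hNK d'
  have hsignN : -W.rootNumber * (-1) ^ (n * ℓ').primeFactors.card = -e₀ := by
    rw [hNcard, pow_succ, he₀def]; ring
  rw [hsignN] at hκ'sign
  have hysign : conjAct W τ ((p ^ 1 : ℕ) : ℤ) y = (-e₀) • y :=
    conjAct_eq_smul_of_torsionH1OfDvd W τ _ (torsionH1OfDvd_pow_injective_of_irreducible W hK hp hirr 1 u) (-e₀) y
      (by rw [hrooty]; exact hκ'sign)
  have hySel : y ∈ (selmerF W ((p ^ 1 : ℕ) : ℤ) 𝒯 (placesDividing K (n * ℓ'))).selmerGroup :=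
    rootClass_mem_selmerGroup_selmerF_of_levelUp_of_irreducible W h𝒯 hK hD3 hD4 hH hp2 hirr hpN hcop' hGZ hN
      hNK d' Q' hA1' hQ' hQ'P hA' hP'
      (fun ℓ hℓ ↦ kolyvaginClass_mem_transverseKer W hK hD hp2 Dt β ι (1 + u) hN hNK d' hℓ)
  have htriv' : ∀ (g : absoluteGaloisGroup (v'.adicCompletion K))
      (P : geomTorsion (W.baseChange K) ((p ^ (1 + u) : ℕ) : ℤ)), resGal (K := K) (v'.adicCompletion K) g • P = P :=
    Walk.resGal_adicCompletion_smul_torsion_eq_self W hK hKol' h1u v' hv'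
  have hyv'0 : galoisCohomology.localization ((W.baseChange K).torsionGaloisModule ((p ^ 1 : ℕ) : ℤ))
      (Sum.inr v' : Place K) 1 y ≠ 0 := by
    intro h
    apply hκ'v'
    rw [← hrooty]
    exact (localization_eq_zero_iff_torsionH1OfDvd W hdn (pow_ne_zero 1 hp.ne_zero)
      (pow_ne_zero _ hp.ne_zero) v' htriv' y).mp h
  have hv'N : v' ∈ placesDividing K (n * ℓ') := by
    rw [mem_placesDividing_iff_natCast_mem hN0, Nat.cast_mul]
    exact v'.asIdeal.mul_mem_left _ hv'
  have hyv' : galoisCohomology.localization ((W.baseChange K).torsionGaloisModule ((p ^ 1 : ℕ) : ℤ))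
      (Sum.inr v' : Place K) 1 y ∉
      (W.baseChange K).kummerSelmerStructure ((p ^ 1 : ℕ) : ℤ) (Sum.inr v') := by
    intro hKum
    have hT : galoisCohomology.localization ((W.baseChange K).torsionGaloisModule ((p ^ 1 : ℕ) : ℤ))
        (Sum.inr v' : Place K) 1 y ∈ 𝒯 (Sum.inr v') :=
      ((mem_selmerGroup_selmerF_iff W _ 𝒯 hN0 _).mp hySel).2 v' hv'N
    exact hyv'0 ((hdisj ℓ' hKol' v' hv').le_bot ⟨hKum, hT⟩)
  have hmn : n / l₀ ∣ n := Nat.div_dvd_of_dvd hl₀n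
  have hm : Squarefree (n / l₀) := hn.squarefree_of_dvd hmn
  have hm0 : n / l₀ ≠ 0 := hm.ne_zero
  have hmK : ∀ q ∈ (n / l₀).primeFactors, Zhang2014.IsKolyvaginPrime (W.conductorNorm ℤ) W K p q :=
    fun q hq ↦ (hnK q (Nat.primeFactors_mono hmn hn0 hq)).1
  have hl₀m : l₀ ∉ (n / l₀).primeFactors := by
    intro h
    have hdvd₂ : l₀ * l₀ ∣ n := by
      have := Nat.mul_dvd_mul_left l₀ (Nat.dvd_of_mem_primeFactors h)
      rwa [Nat.mul_div_cancel' hl₀n] at this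
    exact hl₀p.one_lt.ne' (Nat.isUnit_iff.mp (hn l₀ hdvd₂))
  have hℓ'm : ℓ' ∉ (n / l₀).primeFactors := fun h ↦ hℓ'n (Nat.primeFactors_mono hmn hn0 h)
  have hfix₀ : τ • v₀ = v₀ := smul_place_eq_self_of_natCast_mem τ hl₀p.ne_zero hKol₀.2.2.2.2.1 v₀ hv₀
  have hv₀m : v₀ ∉ placesDividing K (n / l₀) := by
    rw [mem_placesDividing_iff_natCast_mem hm0, natCast_mem_iff_exists_primeFactor_mem hm0]
    rintro ⟨q, hq, hqv⟩
    have := Walk.prime_eq_of_natCast_mem v₀ (Nat.prime_of_mem_primeFactors hq) hl₀p hqv hv₀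
    exact hl₀m (this ▸ hq)
  have hv'v₀ : v' ≠ v₀ := by
    rintro rfl
    have := Walk.prime_eq_of_natCast_mem v' hℓ'p hl₀p hv' hv₀
    exact hℓ'n (this ▸ hl₀)
  have hyF : ∀ w : HeightOneSpectrum (𝓞 K), w ≠ v₀ → w ≠ v' →
      galoisCohomology.localization ((W.baseChange K).torsionGaloisModule ((p ^ 1 : ℕ) : ℤ))
        (Sum.inr w : Place K) 1 y ∈ selmerF W ((p ^ 1 : ℕ) : ℤ) 𝒯 (placesDividing K (n / l₀)) (Sum.inr w) := by
    intro w hw₀ hw'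
    obtain ⟨hKum, hT⟩ := (mem_selmerGroup_selmerF_iff W _ 𝒯 hN0 _).mp hySel
    have hcover : ∀ q ∈ (n * ℓ').primeFactors, (q : 𝓞 K) ∈ w.asIdeal → q ∈ (n / l₀).primeFactors := by
      intro q hq hqw
      rw [hNpf, Finset.mem_union, Finset.mem_singleton] at hq
      rcases hq with hq | rfl
      · by_contra hqm
        have hqn := Nat.dvd_of_mem_primeFactors hq
        have hql₀ : q = l₀ := by
          by_contra hne
          apply hqm
          refine Nat.mem_primeFactors.mpr ⟨Nat.prime_of_mem_primeFactors hq, ?_, hm0⟩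
          have hcop : Nat.Coprime q l₀ :=
            (Nat.coprime_primes (Nat.prime_of_mem_primeFactors hq) hl₀p).mpr hne
          exact (hcop.dvd_mul_right).mp (by rw [Nat.div_mul_cancel hl₀n]; exact hqn)
        subst hql₀
        exact hw₀ (Walk.place_eq_of_natCast_mem_of_isPrime hl₀p.ne_zero hKol₀.2.2.2.2.1 w v₀ hqw hv₀)
      · exact absurd (Walk.place_eq_of_natCast_mem_of_isPrime hℓ'p.ne_zero hKol'.2.2.2.2.1 w v' hqw hv')
          hw'
    rw [selmerF_inr]
    by_cases hw : w ∈ placesDividing K (n / l₀)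
    · rw [if_pos hw]
      refine hT w ?_
      rw [mem_placesDividing_iff_natCast_mem hm0] at hw
      rw [mem_placesDividing_iff_natCast_mem hN0]
      have : (n / l₀ : ℕ) ∣ n * ℓ' := hmn.trans (Dvd.intro ℓ' rfl)
      obtain ⟨c, hc⟩ := this
      rw [hc, Nat.cast_mul]
      exact w.asIdeal.mul_mem_right _ hw
    · rw [if_neg hw]
      refine hKum (Sum.inr w) fun q hq hP ↦ hw ?_
      obtain ⟨w₁, hw₁, hqw₁⟩ := hP
      cases hw₁
      rw [mem_placesDividing_iff_natCast_mem hm0, natCast_mem_iff_exists_primeFactor_mem hm0]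
      exact ⟨q, hcover q hq hqw₁, hqw₁⟩
  have hs : (-e₀ = 1 ∨ -e₀ = -1) := by
    obtain ⟨he₀, -⟩ := JetchevIrreducibleReadingSign.sign_conjAct_kolyvaginClass_of_irreducible hK hD3 hD4 hH
      hp2 hirr hpN τ hτ1 Dt β ι hn (k := 1 + u) (by omega) hnK d
    rcases he₀ with h | h <;> [right; left] <;> omega
  have htsign : conjAct W τ ((p ^ 1 : ℕ) : ℤ) t = (-e₀) • t := ((mem_signPart_iff W K τ _ _ _ t).mp ht).2
  have htF := ((mem_signPart_iff W K τ _ _ _ t).mp ht).1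
  have hy₀ : galoisCohomology.localization ((W.baseChange K).torsionGaloisModule ((p ^ 1 : ℕ) : ℤ))
      (Sum.inr v₀ : Place K) 1 y ≠ 0 := by
    intro hy0
    exact htv' (localization_eq_zero_of_strict_of_relaxed W τ p 1 e hμ hadd₁ hadd₂ hgal halt hnondeg hτe
      hττ hp2 le_rfl inv hperf hvan hSC hinv 𝒯 hm0 (h𝒯σ _ hm hmK) (h𝒯sd _ hm hmK) hs hp
      (fun ℓ hℓ hk _ v hv hfix ↦ by rw [hloc ℓ hℓ hk v hv hfix _ hs, pow_one]) hfix₀ hv₀m hKol'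
      (le_trans (by omega) h1u) hℓ'm hv' hv'v₀ y hysign hyF hy0 hyv' t htsign htF)
  have h1u₀ : 1 + u ≤ Zhang2014.kolyvaginIndex W p l₀ := (hnK l₀ hl₀).2
  have htriv₀ : ∀ (g : absoluteGaloisGroup (v₀.adicCompletion K))
      (P : geomTorsion (W.baseChange K) ((p ^ (1 + u) : ℕ) : ℤ)), resGal (K := K) (v₀.adicCompletion K) g • P = P :=
    Walk.resGal_adicCompletion_smul_torsion_eq_self W hK hKol₀ h1u₀ v₀ hv₀
  have hκ'v₀ : galoisCohomology.localization ((W.baseChange K).torsionGaloisModule ((p ^ (1 + u) : ℕ) : ℤ))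
      (Sum.inr v₀ : Place K) 1 (d'.kolyvaginClass hp (1 + u)) ≠ 0 := by
    rw [← hrooty]
    exact fun h ↦ hy₀ ((localization_eq_zero_iff_torsionH1OfDvd W hdn (pow_ne_zero 1 hp.ne_zero)
      (pow_ne_zero _ hp.ne_zero) v₀ htriv₀ y).mpr h)
  have hn''eq : n / l₀ * ℓ' * l₀ = n * ℓ' := by
    rw [mul_right_comm, Nat.div_mul_cancel hl₀n]
  have hl₀'' : ¬ l₀ ∣ n / l₀ * ℓ' := by
    intro h
    have : l₀ * l₀ ∣ n / l₀ * ℓ' * l₀ := by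
      rw [mul_comm (n / l₀ * ℓ') l₀]; exact Nat.mul_dvd_mul_left l₀ h
    rw [hn''eq] at this
    exact hl₀p.one_lt.ne' (Nat.isUnit_iff.mp (hN l₀ this))
  have h44₀ := addOrderOf_localization_kolyvaginClass_eq_of_h47row_cast W p Dt β ι G h47row (1 + u)
    (by omega) hn''eq hN hl₀p hGl₀ hl₀'' hNK d'' d' hσ₁ hS₁ hS₁' hemb₁ v₀ hv₀
  have hκ''v₀ : galoisCohomology.localization ((W.baseChange K).torsionGaloisModule ((p ^ (1 + u) : ℕ) : ℤ))
      (Sum.inr v₀ : Place K) 1 (d''.kolyvaginClass hp (1 + u)) ≠ 0 := by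
    intro h
    have h' := h44₀
    rw [show (galoisCohomology.localization ((W.baseChange K).torsionGaloisModule ((p ^ (1 + u) : ℕ) : ℤ))
      (Sum.inr v₀ : Place K) 1 : galH1Torsion (W.baseChange K) ((p ^ (1 + u) : ℕ) : ℤ) →+ _)
      (d''.kolyvaginClass hp (1 + u)) = 0 from h, addOrderOf_zero] at h'
    exact hκ'v₀ (AddMonoid.addOrderOf_eq_one_iff.mp h')
  have hκ''0 : d''.kolyvaginClass hp (1 + u) ≠ 0 := fun h ↦ hκ''v₀ (by rw [h]; exact map_zero _)
  obtain ⟨hA'', hP''⟩ := d''.kolyvaginClass_ne_zero hκ''0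
  rintro ⟨Q, hQ⟩
  have h1 := (zsmul_kolyvaginClass_eq_zero_iff d'' hp (1 + u) hA'' hP'' 1).mpr
    ⟨Q, by rw [one_zsmul, Nat.add_comm]; exact hQ⟩
  exact hκ''0 (by rwa [one_zsmul] at h1)


end Prime

end Summit.BirchSwinnertonDyer.BirchSwinnertonDyer.Theorems.JetchevIrreducibleSwap

end
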